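import Summits.CriticalPhenomena.SAWScalingLimit.Theses.SAWCompassLattice
import Summits.CriticalPhenomena.SAWScalingLimit.Theorems.SAWCompassLatticeCompassSLEIffYBSquareSLE
import Summits.CriticalPhenomena.SAWScalingLimit.Theorems.SAWCompassLatticeCompassSLEYbCriterion
import Summits.CriticalPhenomena.SAWScalingLimit.Theorems.SAWCompassLatticeCompassSLEYbSubseqLimitChordal
import Summits.CriticalPhenomena.SAWScalingLimit.Theorems.SAWChargeContinuationSAWAvoidanceLawOfScalingLimit
import Summits.CriticalPhenomena.SAWScalingLimit.Theorems.SAWSteinDefectSLEAvoidanceValue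
import Summits.CriticalPhenomena.SAWScalingLimit.Theorems.SAWDevelopingMapHexTransferDictionaryGlue
import Literature.Probability.RandomPlanarGeometry.LocalMartingaleProofs

/-!
# The restriction-law stub of the `CompassSLE` skeleton is NECESSARY (crux stmt-CriticalPhenomena-6965,
# line `registered` = `birth`, lead c2)

Honesty certificate for the open stub I1 `stub_ybRestrictionLaw` of `Cruxes/CompassSLE/Lines/birth.lean`
(v4): the Lawler–Schramm–Werner `5/8` restriction law for Glazman–Manolescu's critical `π/2`
Yang–Baxter walk is a CONSEQUENCE of the crux. With the landed certificates for I (identification)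
and I2b (simplicity) in `…CompassSLEStubsNecessary.lean` and the T-side certificate, this makes the
three-way split `CompassSLE ⇐ T1 ∧ I1 ∧ I2b` (`…CompassSLEReduction.lean`) an equivalence.

* `ybRestrictionLaw_of_convergesInLawToSLE` — pointwise in the Dobrushin domain and the port
  endpoint approximation: if the `π/2` Yang–Baxter curve laws converge in law to chordal SLE(8/3) in
  `(D; a, b)`, then for every hull subdomain `D'` (ε-ball form), chordal uniformizer `φ` and restriction
  data `(Φ, d)` of `φ.pullbackHull D'`, `P^{YB}_δ(range ⊆ closure D') → d^{5/8}` along `𝓝[>] 0`.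
  Proof: the portmanteau SANDWICH of the tree (`SAWChargeContinuation.tendsto_of_sandwich`) with the
  closed event `E = {range ⊆ cl D'}` and the open event `O = {range misses cl (D ∖ D')}`: on the
  lattice, once `a δ ≠ b δ`, the drawn walk lies in `D` (`range_path_subset_of_ne`), so
  `{curve ∈ O} ⊆ {curve ∈ E}`; under the SLE(8/3) law `μ` the difference `E ∖ O` is null
  (`MutualAvoidanceLaw.sle_measure_diff_avoid_eq_zero`, [LSW] Thm. 6.1 transposed + Rohde–Schramm),
  and `μ E = d^{5/8}` (`SLEAvoidanceValue_pullbackHull_proof`, [LSW] Thm. 6.1, value form).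
* `ybRestrictionLaw_of_ybSquareSLE` — `YBSquareSLE →` stub I1 verbatim.
* `ybRestrictionLaw_of_compassSLE` — `CompassSLE →` stub I1 verbatim (through the landed
  `compassSLE_iff_ybSquareSLE`).

No named fact is used. References: G. F. Lawler, O. Schramm, W. Werner, *Conformal restriction: the
chordal case*, J. Amer. Math. Soc. 16 (2003), Thm. 6.1; P. Billingsley, *Convergence of Probability
Measures* (1999), Thm. 2.1.
-/

noncomputable section

namespace Summit.CriticalPhenomena.SAWScalingLimit.Theorems.SAWCompassLatticeCompassSLE

open MeasureTheory Filter Topology Set Metric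
open scoped NNReal ENNReal BoundedContinuousFunction
open Literature.Probability Literature.Probability.RandomPlanarGeometry
open Literature.Probability.RandomPlanarGeometry.SAW.YangBaxter
open UpperHalfPlane (upperHalfPlaneSet)
open Summit.CriticalPhenomena.SAWScalingLimit.Theses

/-- **The `5/8` restriction law is forced by convergence to SLE(8/3)** (pointwise form). If the
curve laws of GM's critical `π/2` Yang–Baxter walk in `(D; a_δ, b_δ)` converge in law to chordal
SLE(8/3), then for every hull subdomain `D'` of `D` (ε-ball form), chordal uniformizer `φ` and
restriction data `(Φ, d)` of `φ.pullbackHull D'`, the lattice probability of `{range ⊆ closure D'}`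
tends to `d^{5/8}` along `𝓝[>] 0` (portmanteau sandwich; the touching event is SLE(8/3)-null).
[cite: LawlerSchrammWerner2003Restriction, Thm. 6.1 (p. 23)] -/
theorem ybRestrictionLaw_of_convergesInLawToSLE {D : DobrushinDomain} {a b : ℝ → MidEdge}
    (hab : IsYBEndpointApprox (fun (_ : ℤ) => Real.pi / 2) D a b)
    (hconv : ConvergesInLawToSLE ((8 : ℝ≥0) / 3) D
      (fun δ (γ : YangBaxterSAW (fun (_ : ℤ) => Real.pi / 2) D.carrier δ (a δ) (b δ)) =>
        γ.curve (fun (_ : ℤ) => Real.pi / 2) δ)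
      (fun δ => ybLaw (fun (_ : ℤ) => Real.pi / 2) D.carrier δ 1 (a δ) (b δ)))
    (D' : DobrushinDomain) (hsub : D'.carrier ⊆ D.carrier) (h0 : D'.pt 0 = D.pt 0)
    (h1 : D'.pt 1 = D.pt 1)
    (hε : ∃ ε : ℝ, 0 < ε ∧ D'.carrier ∩ Metric.ball (D.pt 0) ε = D.carrier ∩ Metric.ball (D.pt 0) ε ∧
      D'.carrier ∩ Metric.ball (D.pt 1) ε = D.carrier ∩ Metric.ball (D.pt 1) ε)
    (φ : ConformalEquiv upperHalfPlaneSet D.carrier) (hφ : D.IsChordalUniformizing φ)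
    (Φ : ConformalEquiv (upperHalfPlaneSet \ φ.pullbackHull D') upperHalfPlaneSet) (d : ℝ)
    (hΦ : IsRestrictionMap (φ.pullbackHull D') Φ) (hd : HasRestrictionDeriv (φ.pullbackHull D') Φ d) :
    Tendsto (fun δ => ((ybLaw (fun (_ : ℤ) => Real.pi / 2) D.carrier δ 1 (a δ) (b δ)).map
        (fun γ => γ.curve (fun (_ : ℤ) => Real.pi / 2) δ))
        (CurveClass.rangeSubset (closure D'.carrier)))
      (𝓝[>] (0 : ℝ)) (𝓝 (ENNReal.ofReal (d ^ ((5 : ℝ) / 8)))) := by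
  classical
  set Θ : ℤ → ℝ := fun _ => Real.pi / 2 with hΘ
  have hHull : D.IsHullSubdomain D' :=
    IsingBoundaryRatio.Negative.isHullSubdomain_of_conds hsub h0 h1 hε
  -- the scaling limit: an SLE(8/3) curve `Γ` and its law `μ`
  obtain ⟨Γ, hΓ, -, hT⟩ := hconv
  haveI := isProbabilityMeasure_preWienerMeasure'
  set μ : Measure (CurveClass ℂ) := Process.preWienerMeasure.map Γ with hμdef
  have hμ : IsSLELaw ((8 : ℝ≥0) / 3) D μ := ⟨Γ, hΓ, rfl⟩
  haveI : IsProbabilityMeasure μ := Measure.isProbabilityMeasure_map hΓ.aemeasurable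
  -- the pushed-forward lattice laws converge weakly to `μ` and are eventually probability measures
  set ν : ℝ → Measure (CurveClass ℂ) := fun δ =>
    (ybLaw Θ D.carrier δ 1 (a δ) (b δ)).map (fun γ => γ.curve Θ δ) with hν
  have hmeas : ∀ δ, Measurable (fun γ : YangBaxterSAW Θ D.carrier δ (a δ) (b δ) => γ.curve Θ δ) :=
    fun δ => YBWalk.measurable_of_top _
  have hprob : ∀ᶠ δ in 𝓝[>] (0 : ℝ), IsProbabilityMeasure (ν δ) := by
    filter_upwards [eventually_isProbabilityMeasure_ybLaw D hab] with δ hδ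
    exact Measure.isProbabilityMeasure_map (hmeas δ).aemeasurable
  have hlim : ∀ f : CurveClass ℂ →ᵇ ℝ,
      Tendsto (fun δ => ∫ x, f x ∂ν δ) (𝓝[>] (0 : ℝ)) (𝓝 (∫ x, f x ∂μ)) := by
    intro f
    have h : Tendsto (fun δ => ∫ γ, f (γ.curve Θ δ) ∂(ybLaw Θ D.carrier δ 1 (a δ) (b δ)))
        (𝓝[>] (0 : ℝ)) (𝓝 (∫ ω, f (Γ ω) ∂Process.preWienerMeasure)) := hT f
    rw [hμdef, integral_map hΓ.aemeasurable f.continuous.aestronglyMeasurable]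
    refine h.congr' (Eventually.of_forall fun δ => ?_)
    exact (integral_map (hmeas δ).aemeasurable f.continuous.aestronglyMeasurable).symm
  -- the closed and the open event, equal under `μ` up to a null set, and the value `μ E`
  set E : Set (CurveClass ℂ) := CurveClass.rangeSubset (closure D'.carrier) with hE
  set O : Set (CurveClass ℂ) :=
    CurveClass.rangeSubset (closure (D.carrier \ D'.carrier))ᶜ with hO
  have hEc : IsClosed E := CurveClass.isClosed_rangeSubset isClosed_closure
  have hOo : IsOpen O := CurveClass.isOpen_rangeSubset isClosed_closure.isOpen_compl
  have hnull : μ (E \ O) = 0 := MutualAvoidanceLaw.sle_measure_diff_avoid_eq_zero hHull hμ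
  have hval : μ E = ENNReal.ofReal (d ^ ((5 : ℝ) / 8)) :=
    _root_.Summit.CriticalPhenomena.SAWScalingLimit.Theorems.SLEAvoidanceValue_pullbackHull_proof
      D D' μ hμ hsub h0 h1 hε φ hφ Φ d hΦ hd
  -- the lattice side: once `a δ ≠ b δ` the drawn walk lies in `D`, so `{curve ∈ O} ⊆ {curve ∈ E}`
  have hOE : ∀ᶠ δ in 𝓝[>] (0 : ℝ), ν δ O ≤ ν δ E := by
    filter_upwards [Cruxes.HexTransfer.YbRelay.eventually_ne_of_isYBEndpointApprox hab] with δ hne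
    simp only [hν]
    rw [Measure.map_apply (hmeas δ) hOo.measurableSet, Measure.map_apply (hmeas δ) hEc.measurableSet]
    refine measure_mono fun γ hγ => ?_
    simp only [mem_preimage, hO, hE, CurveClass.mem_rangeSubset] at hγ ⊢
    intro z hz
    have hzD : z ∈ D.carrier := by
      have hr : (γ.curve Θ δ).range = Set.range (γ.path Θ δ) := CurveClass.range_mk _
      rw [hr] at hz
      exact range_path_subset_of_ne γ hne hz
    have hz' : z ∉ closure (D.carrier \ D'.carrier) := hγ hz
    by_contra hzD'
    exact hz' (subset_closure ⟨hzD, fun h => hzD' (subset_closure h)⟩)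
  have hlimit := SAWChargeContinuation.tendsto_of_sandwich hprob hlim hEc hOo hnull (fun δ => ν δ E)
    hOE (Eventually.of_forall fun δ => le_rfl)
  rw [hval] at hlimit
  exact hlimit

/-- **`YBSquareSLE` forces stub I1** (`stub_ybRestrictionLaw` of `Cruxes/CompassSLE/Lines/birth.lean`
is necessary): the `5/8` restriction law for GM's critical `π/2` walk, verbatim the registered
signature, follows from chordal SLE(8/3) convergence of that walk.
[cite: LawlerSchrammWerner2003Restriction, Thm. 6.1 (p. 23)] -/
theorem ybRestrictionLaw_of_ybSquareSLE :
    SAWCompassLattice.YBSquareSLE →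
    ∀ (D D' : DobrushinDomain) (a b : ℝ → MidEdge),
      IsYBEndpointApprox (fun (_ : ℤ) => Real.pi / 2) D a b →
      D'.carrier ⊆ D.carrier → D'.pt 0 = D.pt 0 → D'.pt 1 = D.pt 1 →
      (∃ ε : ℝ, 0 < ε ∧ D'.carrier ∩ Metric.ball (D.pt 0) ε = D.carrier ∩ Metric.ball (D.pt 0) ε ∧
        D'.carrier ∩ Metric.ball (D.pt 1) ε = D.carrier ∩ Metric.ball (D.pt 1) ε) →
      ∀ (φ : ConformalEquiv upperHalfPlaneSet D.carrier), D.IsChordalUniformizing φ →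
      ∀ (Φ : ConformalEquiv (upperHalfPlaneSet \ φ.pullbackHull D') upperHalfPlaneSet) (d : ℝ),
        IsRestrictionMap (φ.pullbackHull D') Φ → HasRestrictionDeriv (φ.pullbackHull D') Φ d →
        Tendsto (fun δ => ((ybLaw (fun (_ : ℤ) => Real.pi / 2) D.carrier δ 1 (a δ) (b δ)).map
            (fun γ => γ.curve (fun (_ : ℤ) => Real.pi / 2) δ))
            (CurveClass.rangeSubset (closure D'.carrier)))
          (𝓝[>] (0 : ℝ)) (𝓝 (ENNReal.ofReal (d ^ ((5 : ℝ) / 8)))) :=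
  fun hY D D' a b hab hsub h0 h1 hε φ hφ Φ d hΦ hd =>
    ybRestrictionLaw_of_convergesInLawToSLE hab (hY D a b hab) D' hsub h0 h1 hε φ hφ Φ d hΦ hd

/-- **`CompassSLE` forces stub I1**: through the landed equivalence `CompassSLE ↔ YBSquareSLE`
(`compassSLE_iff_ybSquareSLE`), the crux itself implies the `5/8` restriction law for GM's `π/2`
walk. Hence a refutation of I1 refutes the crux (and the route).
[cite: LawlerSchrammWerner2003Restriction, Thm. 6.1 (p. 23)] -/
theorem ybRestrictionLaw_of_compassSLE :
    SAWCompassLattice.CompassSLE →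
    ∀ (D D' : DobrushinDomain) (a b : ℝ → MidEdge),
      IsYBEndpointApprox (fun (_ : ℤ) => Real.pi / 2) D a b →
      D'.carrier ⊆ D.carrier → D'.pt 0 = D.pt 0 → D'.pt 1 = D.pt 1 →
      (∃ ε : ℝ, 0 < ε ∧ D'.carrier ∩ Metric.ball (D.pt 0) ε = D.carrier ∩ Metric.ball (D.pt 0) ε ∧
        D'.carrier ∩ Metric.ball (D.pt 1) ε = D.carrier ∩ Metric.ball (D.pt 1) ε) →
      ∀ (φ : ConformalEquiv upperHalfPlaneSet D.carrier), D.IsChordalUniformizing φ →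
      ∀ (Φ : ConformalEquiv (upperHalfPlaneSet \ φ.pullbackHull D') upperHalfPlaneSet) (d : ℝ),
        IsRestrictionMap (φ.pullbackHull D') Φ → HasRestrictionDeriv (φ.pullbackHull D') Φ d →
        Tendsto (fun δ => ((ybLaw (fun (_ : ℤ) => Real.pi / 2) D.carrier δ 1 (a δ) (b δ)).map
            (fun γ => γ.curve (fun (_ : ℤ) => Real.pi / 2) δ))
            (CurveClass.rangeSubset (closure D'.carrier)))
          (𝓝[>] (0 : ℝ)) (𝓝 (ENNReal.ofReal (d ^ ((5 : ℝ) / 8)))) :=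
  fun hC => ybRestrictionLaw_of_ybSquareSLE (compassSLE_iff_ybSquareSLE.1 hC)

end Summit.CriticalPhenomena.SAWScalingLimit.Theorems.SAWCompassLatticeCompassSLE

end
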